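import Summits.NavierStokesRegularity.NavierStokesRegularity.Theorems.StrainDoorsNearRecordClockBounds
import Literature.Analysis.FluidPDE.KNSSThm52Integrand
import HarnessLib

/-!
# StrainDoorsNearRecordClockRate — PART M §M11: TIME REGULARITY OF THE TYPE-I CLASS AND THE CLOCK LAW WITH A RATE

(S-lane landing file 2/2 of text D1: the ★★★ theorem `typeI_nearRecord_clock_rate` with its STATEMENT BYTE-IDENTICAL to
nsreg-p1 g36 r63/StrainDoorsNearRecordClockRate.lean sha256 eef3c1babb00a640; proof = the author's l.366–449 + l.723–765 verbatim,
the window block l.450–722 replaced by a call of `typeI_frozenPoint_clock_bounds` (`StrainDoorsNearRecordClockBounds`), to meet the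
400-line cap (LEAD ruling 08:34Z); hand ns-s29-p2 g6.)

nsreg-p1 g36, ROUND-63 (helper lane of `stmt-NavierStokesRegularity-0056`, rung N0; 0 ledger writes by the
planner — text for the S-lane to land `--supports stmt-NavierStokesRegularity-0056 --as helper`; tree file 4 of 5
of ROUND-63; bodies farm-certified inside `r63/StrainDoorsR63All.lean`, rc 0 · 0 warn · 0 sorry, std axioms).

ROUNDS 53/60 recorded the CLOCK IDENTITY at an interior space-time maximum of the scale-invariant vorticity
`(T − t)|ω|`: `|ω|² = (T − t)⟪ω, ∂ₜω⟫` (Fermat in time).  This file makes it QUANTITATIVE at NEAR-records of a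
classical Type-I ancient solution, with no blow-up sequence: if `(0 − s)|ω(s,x)| ≤ W` along the world-line of the
point `x` (all `s < 0`) and `(0 − t)|ω(t,x)| ≥ W − δ`, then
`((0 − t)³⟪ω, ∂ₜω⟫(t,x) − ((0 − t)|ω(t,x)|)²)² ≤ A(C₀)·W·δ`.
Mechanism: rescale to time `−1`; `G(s) = (0 − s)²|ω'(s,z)|²` is `≤ W²` for all `s < 0` and `≥ (W − δ)²` at `s = −1`;
its derivative `Γ = G'` exists (the vorticity equation holds pointwise for classical solutions:
`classical_vorticity_hasDerivAt`) and is Lipschitz near `−1` UNIFORMLY IN THE CLASS, because the KNSS smooth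
representative has time-Lipschitz space derivatives of every order `k ≤ 3` (`exists_uniform_timeLipschitz`, a
fixed-window transfer of the KNSS a-priori estimate) and the class has uniform `C³` bounds; the elementary
local Fermat-with-rate lemma `abs_le_two_sqrt_of_local_taylor` then gives `Γ(−1)² ≤ 4(W² − G(−1))(L + 2C) ≤ A·W·δ`,
and `Γ(−1) = 2[(0 − t)³⟪ω, ∂ₜω⟫ − ((0 − t)|ω|)²](t,x)` by the parabolic scale law (`λ⁶`).

* `window_transfer_fderiv₂_time`, `window_transfer_fderiv₃_time` — a.e.-to-everywhere transfer of time-Lipschitz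
  bounds of `∇²U`, `∇³U` from the KNSS representative to the classical field;
* ★ `exists_uniform_timeLipschitz` — ONE constant `L(C₀)` with `‖∇ᵏu(t,x) − ∇ᵏu(s,x)‖ ≤ L|t − s|` for `k < 4`,
  `t ≤ −1/4`, `t − 1 < s ≤ t`, for every classical Type-I solution of the class;
* ★ `classical_vorticity_hasDerivAt` — the vorticity equation `∂ₜω = Δω − ∇ω·u + ∇u·ω` as a `HasDerivAt` statement
  in time at every point, for classical solutions on `(−∞,0)`;
* `abs_le_two_sqrt_of_local_taylor` — 1-D Fermat with a rate at a near-maximum, local version (Lipschitz derivative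
  on `|s − a| ≤ r`, a-priori bound `|G'(a)| ≤ C` for the far range): `|G'(a)| ≤ 2√((M − G(a))(L + C/r))`;
* ★★★ `typeI_nearRecord_clock_rate` — THE CLOCK LAW WITH A RATE (above).

WHAT THIS IS NOT: a necessary condition at near-record points; nothing here excludes a blow-up; `0056` / `10661` /
NS regularity are NOT proved; the peak doors of PART K stay OPEN.  No new definitions; no sorry.
[cite: KochNadirashviliSereginSverak2009, §2 p. 5, (4.11); ChaeWolf2017RemovingDSS, §3 Step 2;
ConstantinFefferman1993, §1]
-/

noncomputable section

open MeasureTheory Set Function Filter Metric Real InnerProductSpace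
open _root_.Topology
open scoped ENNReal NNReal RealInnerProductSpace ContDiff Laplacian
open Literature.Analysis Literature.Analysis.FluidPDE
open Literature.Analysis.FluidPDE.VorticityDirectionDynamics

set_option linter.dupNamespace false
set_option maxSynthPendingDepth 3

namespace Summit.NavierStokesRegularity.NavierStokesRegularity.Theorems.StrainDoors

open Summit.NavierStokesRegularity.NavierStokesRegularity.Theorems.ArgmaxDoors

/-! ## §M11 (continued) The clock law with a rate -/

set_option maxHeartbeats 800000 in
/-- ★★★ **THE CLOCK LAW WITH A RATE (time-criticality of near-records, compactness-free).**  For every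
`C₀ ≥ 0` there is `A = A(C₀) ≥ 0` such that for every classical Type-I solution on `(−∞,0) × ℝ³`, every
`t < 0`, `W`, `δ ≥ 0` and every point `x` with `(0 − s)|ω(s,x)| ≤ W` FOR ALL `s < 0` (domination along the
world-line of `x`) and `(0 − t)|ω(t,x)| ≥ W − δ`:
`((0 − t)³·⟪ω, Δω − ∇ω·u + ∇u·ω⟫(t,x) − ((0 − t)|ω(t,x)|)²)² ≤ A·W·δ`,
i.e. `(0 − t)·∂ₜ log|ω|(t,x) = 1 + O(√δ)/((0 − t)|ω|)²`: at a near-record the vorticity modulus grows at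
EXACTLY the self-similar rate, with the explicit rate `√δ`.  Proof: rescale to `t = −1`; `G(s) =
((0 − s)|ω'(s,z)|)² ≤ W²` for all `s < 0`, `G(−1) ≥ (W − δ)²`; `G' = Γ` by the pointwise vorticity equation
(`classical_vorticity_hasDerivAt`); `Γ` is Lipschitz at `−1` on `[−3/2, −1/2]` and bounded, uniformly in the
class, by the uniform space bounds of orders `≤ 3` and the uniform time-Lipschitz bounds of orders `≤ 3`
(`exists_uniform_timeLipschitz`); then `abs_le_two_sqrt_of_local_taylor`.  The `δ = 0` case is the record
identity of ROUNDS 53/60 `|ω|² = (T − t)⟪ω, ∂ₜω⟫` at an interior space-time maximum. [new-as-typed] -/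
theorem typeI_nearRecord_clock_rate {C₀ : ℝ} (hC₀ : 0 ≤ C₀) :
    ∃ A : ℝ, 0 ≤ A ∧
      ∀ (u : ℝ → (EuclideanSpace ℝ (Fin 3)) → (EuclideanSpace ℝ (Fin 3))) (p : ℝ → (EuclideanSpace ℝ (Fin 3)) → ℝ)
        (W t δ : ℝ) (x : EuclideanSpace ℝ (Fin 3)),
        IsClassicalNSSolutionOn (Iio 0) 1 0 u p → HasTypeIDecay C₀ u → t < 0 →
        (∀ s : ℝ, s < 0 → (0 - s) * ‖curl (u s) x‖ ≤ W) → 0 ≤ δ → W - δ ≤ (0 - t) * ‖curl (u t) x‖ →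
        ((0 - t) ^ 3 * ⟪curl (u t) x, (Δ (curl (u t))) x - fderiv ℝ (curl (u t)) x (u t x) +
            fderiv ℝ (u t) x (curl (u t) x)⟫ - ((0 - t) * ‖curl (u t) x‖) ^ 2) ^ 2 ≤ A * W * δ := by
  obtain ⟨LΓ, CΓ, hLΓ0, hCΓ0, hFP⟩ := typeI_frozenPoint_clock_bounds hC₀
  refine ⟨2 * (LΓ + CΓ / (1 / 2)), by positivity, fun u p W t δ x hsol hI ht hdom hδ hnear => ?_⟩
  -- rescale to time `-1`
  obtain ⟨lam, hlam⟩ : ∃ lam : ℝ, lam = √(0 - t) := ⟨_, rfl⟩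
  have hlam0 : 0 < lam := by rw [hlam]; exact Real.sqrt_pos.mpr (by linarith)
  have hlam2 : lam ^ 2 = 0 - t := by rw [hlam]; exact Real.sq_sqrt (by linarith)
  have ht1 : lam ^ 2 * (-1) = t := by rw [hlam2]; ring
  obtain ⟨z, hz⟩ : ∃ z : EuclideanSpace ℝ (Fin 3), z = lam⁻¹ • x := ⟨_, rfl⟩
  have hxz : lam • z = x := by rw [hz]; exact smul_inv_smul₀ hlam0.ne' _
  have hcl := (typeI_class_nsRescale hlam0 hsol hI).1
  have hI' := (typeI_class_nsRescale hlam0 hsol hI).2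
  have hcurl : ∀ s, curl (nsRescale lam u s) z = lam ^ 2 • curl (u (lam ^ 2 * s)) x := fun s => by
    rw [curl_eq_curlCLM, curl_eq_curlCLM, fderiv_nsRescale, map_smul, hxz]
  -- the frozen-point time functions of the rescaled solution
  obtain ⟨w, hω⟩ : ∃ w : ℝ → EuclideanSpace ℝ (Fin 3), w = fun s => curl (nsRescale lam u s) z := ⟨_, rfl⟩
  obtain ⟨V, hV⟩ : ∃ V : ℝ → EuclideanSpace ℝ (Fin 3),
      V = fun s => deriv (fun τ => curl (nsRescale lam u τ) z) s := ⟨_, rfl⟩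
  obtain ⟨G, hGdef⟩ : ∃ G : ℝ → ℝ, G = fun s => (0 - s) ^ 2 * ‖w s‖ ^ 2 := ⟨_, rfl⟩
  obtain ⟨Γ, hΓdef⟩ : ∃ Γ : ℝ → ℝ,
      Γ = fun s => -(2 * (0 - s)) * ‖w s‖ ^ 2 + (0 - s) ^ 2 * (2 * ⟪w s, V s⟫) := ⟨_, rfl⟩
  have hωd : ∀ s : ℝ, s < 0 → HasDerivAt w (V s) s := fun s hs => by
    rw [hω, hV]
    exact (classical_vorticity_hasDerivAt hcl hs z).differentiableAt.hasDerivAt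
  have hVval : ∀ s : ℝ, s < 0 → V s = (Δ (curl (nsRescale lam u s))) z -
      fderiv ℝ (curl (nsRescale lam u s)) z (nsRescale lam u s z) +
      fderiv ℝ (nsRescale lam u s) z (curl (nsRescale lam u s) z) := fun s hs => by
    rw [hV]
    exact (classical_vorticity_hasDerivAt hcl hs z).deriv
  have hGd : ∀ s : ℝ, s < 0 → HasDerivAt G (Γ s) s := fun s hs => by
    have h0 : HasDerivAt (fun s : ℝ => 0 - s) (0 - 1) s := (hasDerivAt_const s (0:ℝ)).sub (hasDerivAt_id s)
    have h1 : HasDerivAt (fun y : ℝ => (0 - y) ^ 2 * ‖w y‖ ^ 2)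
        (((2 : ℕ) : ℝ) * (0 - s) ^ (2 - 1) * (0 - 1) * ‖w s‖ ^ 2 + (0 - s) ^ 2 * (2 * ⟪w s, V s⟫)) s :=
      (h0.pow 2).mul (hωd s hs).norm_sq
    rw [hGdef, hΓdef]
    exact h1.congr_deriv (by norm_num)
  -- domination and the near-record in the rescaled picture
  have hWdom : ∀ s : ℝ, s < 0 → (0 - s) * ‖w s‖ ≤ W := fun s hs => by
    have h := hdom (lam ^ 2 * s) (by nlinarith)
    rw [hω]
    dsimp only
    rw [vorticityNumber_nsRescale, hxz]
    exact h
  have hW0 : 0 ≤ W := by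
    have h := hWdom (-1) (by norm_num)
    have : 0 ≤ (0 - (-1 : ℝ)) * ‖w (-1)‖ := by positivity
    linarith
  have hn : ‖w (-1)‖ = (0 - t) * ‖curl (u t) x‖ := by
    have e := vorticityNumber_nsRescale lam u (-1) z
    rw [hxz, ht1] at e
    rw [hω]
    dsimp only
    linarith
  have hnear' : W - δ ≤ ‖w (-1)‖ := by rw [hn]; exact hnear
  have hGM : ∀ s, |s - (-1)| ≤ 1 / 2 → G s ≤ W ^ 2 := fun s hs => by
    have hs0 : s < 0 := by have := (abs_le.1 hs).2; linarith
    rw [hGdef]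
    dsimp only
    rw [← mul_pow]
    have hs1 : 0 < 0 - s := by linarith
    have hpos : 0 ≤ (0 - s) * ‖w s‖ := by positivity
    exact pow_le_pow_left₀ hpos (hWdom s hs0) 2
  have hdef : W ^ 2 - G (-1) ≤ 2 * W * δ := by
    rw [hGdef]
    dsimp only
    have e1 : W ^ 2 - (0 - (-1 : ℝ)) ^ 2 * ‖w (-1)‖ ^ 2 = (W - ‖w (-1)‖) * (W + ‖w (-1)‖) := by ring
    have hle : ‖w (-1)‖ ≤ W := by have := hWdom (-1) (by norm_num); linarith
    have e2 : (W - ‖w (-1)‖) * (W + ‖w (-1)‖) ≤ δ * (W + ‖w (-1)‖) :=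
      mul_le_mul_of_nonneg_right (by linarith) (by positivity)
    have e3 : δ * (W + ‖w (-1)‖) ≤ δ * (2 * W) := mul_le_mul_of_nonneg_left (by linarith) hδ
    linarith
  -- UNIFORM BOUNDS on the window `|s + 1| ≤ 1/2`
  have hwin : ∀ s : ℝ, |s - (-1)| ≤ 1 / 2 → s ≤ -(1 / 4 : ℝ) ∧ s < 0 ∧ 1 / 2 ≤ 0 - s ∧ 0 - s ≤ 3 / 2 :=
    fun s hs => by
      have h1 := (abs_le.1 hs).1; have h2 := (abs_le.1 hs).2
      exact ⟨by linarith, by linarith, by linarith, by linarith⟩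
  have h1' : |(-1:ℝ) - (-1)| ≤ 1 / 2 := by norm_num
  have h1e : (-1:ℝ) = -1 := rfl
  -- `Γ` is Lipschitz at `-1` on the window, and bounded at `-1` (hoisted block `typeI_frozenPoint_clock_bounds`)
  have hFP' := hFP (nsRescale lam u) _ z hcl hI'
  have hΓL : ∀ s, |s - (-1)| ≤ 1 / 2 → |Γ s - Γ (-1)| ≤ LΓ * |s - (-1)| := fun s hs => by
    have h := hFP'.1 s hs
    rw [← hVval s (hwin s hs).2.1, ← hVval (-1) (by norm_num)] at h
    rw [hΓdef, hω]
    exact h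
  have hΓC : |Γ (-1)| ≤ CΓ := by
    have h := hFP'.2
    rw [← hVval (-1) (by norm_num)] at h
    rw [hΓdef, hω]
    exact h
  -- Fermat with a rate in time
  have hF := abs_le_two_sqrt_of_local_taylor (a := -1) (by norm_num : (0:ℝ) < 1 / 2) hLΓ0 hCΓ0
    (fun s hs => hGd s (hwin s hs).2.1) hΓL hGM hΓC
  have hX : 0 ≤ (W ^ 2 - G (-1)) * (LΓ + CΓ / (1 / 2)) :=
    mul_nonneg (by linarith [hGM (-1) (by norm_num)]) (by positivity)
  have hsq : Γ (-1) ^ 2 ≤ 4 * ((W ^ 2 - G (-1)) * (LΓ + CΓ / (1 / 2))) := by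
    have h := pow_le_pow_left₀ (abs_nonneg _) hF 2
    rw [sq_abs, mul_pow, Real.sq_sqrt hX] at h
    linarith
  have hsq' : Γ (-1) ^ 2 ≤ 4 * ((2 * W * δ) * (LΓ + CΓ / (1 / 2))) :=
    hsq.trans (by gcongr)
  -- the scale identities: `Γ(−1) = 2·[(0 − t)³⟪w, ∂ₜω⟫ − ((0 − t)|w|)²](t,x)`
  have hVt := classical_vorticity_hasDerivAt hsol ht x
  have hin : HasDerivAt (fun τ : ℝ => lam ^ 2 * τ) (lam ^ 2) (-1) := by
    simpa using (hasDerivAt_id (-1 : ℝ)).const_mul (lam ^ 2)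
  have hcomp := ((hVt.scomp_of_eq (-1) hin ht1.symm).const_smul (lam ^ 2))
  have hfun : (fun τ => curl (nsRescale lam u τ) z) =
      fun τ => lam ^ 2 • ((fun τ => curl (u τ) x) ∘ (fun τ : ℝ => lam ^ 2 * τ)) τ := by
    funext τ; rw [hcurl τ]; rfl
  have hV1 : V (-1) = lam ^ 2 • lam ^ 2 • ((Δ (curl (u t))) x - fderiv ℝ (curl (u t)) x (u t x) +
      fderiv ℝ (u t) x (curl (u t) x)) := by
    rw [hV]
    dsimp only
    rw [hfun]
    exact hcomp.deriv
  have hω1 : w (-1) = lam ^ 2 • curl (u t) x := by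
    rw [hω]
    dsimp only
    rw [hcurl, ht1]
  have hΓ1 : Γ (-1) = 2 * ((0 - t) ^ 3 * ⟪curl (u t) x, (Δ (curl (u t))) x - fderiv ℝ (curl (u t)) x (u t x) +
      fderiv ℝ (u t) x (curl (u t) x)⟫ - ((0 - t) * ‖curl (u t) x‖) ^ 2) := by
    rw [hΓdef]
    dsimp only
    rw [hn, hω1, hV1, real_inner_smul_left, real_inner_smul_right, real_inner_smul_right, ← hlam2]
    ring
  rw [hΓ1] at hsq'
  have e4 : ∀ Q : ℝ, (2 * Q) ^ 2 = 4 * Q ^ 2 := fun Q => by ring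
  rw [e4] at hsq'
  have e5 : 4 * (2 * W * δ * (LΓ + CΓ / (1 / 2))) = 4 * (2 * (LΓ + CΓ / (1 / 2)) * W * δ) := by ring
  rw [e5] at hsq'
  linarith

end Summit.NavierStokesRegularity.NavierStokesRegularity.Theorems.StrainDoors
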